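import Literature.Analysis.FluidPDE.ElgindiAngularGreenOperator
import Literature.Analysis.FluidPDE.ElgindiGammaKNumerics
import Mathlib.Topology.ContinuousMap.Bounded.Normed
import Mathlib.Topology.MetricSpace.Contracting
import HarnessLib

/-!
# The angular corrector of Elgindi's profile: the resolvent of the angular operator at
`μ₁ = −α(α+5)` by a contraction ([Elgindi2021] §8.3 Proposition 8.13; [ElgindiGhoulMasmoudi2021]
§2.3.1, (2.10)–(2.12))

Topic `Literature/Analysis/FluidPDE`. Support file (definitions with bodies and proved theorems, no
named facts) on the proof path of the named fact
`Literature.Analysis.FluidPDE.Elgindi.ElgindiGhoulMasmoudi2021_stabilityCore`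
(`ElgindiStabilityDecomposition.lean`). T. M. Elgindi, Ann. of Math. 194 (2021) =
arXiv:1904.04795, §8.3 Proposition 8.13 (p. 27): the structure of `Φ_*`, `L_αΦ_* = F_*`, through
"the solution `Φ̃` to `∂_θθΦ̃ − ∂_θ(tan θ Φ̃) = Γ`"; Elgindi–Ghoul–Masmoudi, arXiv:1910.14071, §2.3.1
(p. 8–9): `U(Φ_F) = −3 sin(2θ)/(1+y) + O(α)`, etc.

**The angular corrector.** With `F_* = r(z)Γ(θ)`, `r = 4αz/(c(1+z)²)`, and
`L_z z = μ₁ z`, `μ₁ = −α(α+5)` (`L_z = −α²D_z² − 5αD_z`), the part of `Φ_*` orthogonal to the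
adjoint kernel `K₀ = sin θ cos²θ` is, to leading order at `z = 0`, `r(z)·ψ₁(θ)` where `ψ₁` is **the**
solution of `(L_θ + μ₁)ψ₁ = Γ̄`, `ψ₁(0) = ψ₁(π/2) = 0`, `ψ₁ ⊥ K₀`, with
`Γ̄ = Γ − (5c/4) sin 2θ ⊥ K₀` (`gammaBar`). Writing `ψ₁ = cos θ·χ₁`, `χ₁` is the fixed point of
the affine contraction

`A(χ) = Π𝒦(Γ̄ − μ₁ cos θ·χ)`, `Π(y) = y − (15/2)⟨cos θ·y, K₀⟩ sin θ`,

on bounded continuous functions (`𝒦` the Green's operator of `ElgindiAngularGreenOperator.lean`,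
`|𝒦h| ≤ 10 sup|h|`; Lipschitz constant `≤ 30|μ₁| ≤ 30/39` for `α ≤ 1/200`). This file constructs
`χ₁` (`chiOne`, on `ℝ →ᵇ ℝ`, the functions of `[0, π/2]` being extended by clamping) and records
the fixed-point equation on `[0, π/2]` (`chiOne_eq`), the bounds `‖χ₁‖ ≤ 300`,
`|Γ̄ − μ₁cos θ χ₁| ≤ 10`, and sets `ψ₁ = cos θ·χ₁` (`psiOne`). The differential equation,
orthogonality and boundary values of `ψ₁` are derived in `ElgindiAngularCorrectorODE.lean`.
-/

noncomputable section

open Set Real Filter MeasureTheory intervalIntegral BoundedContinuousFunction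
open _root_.Topology
open scoped NNReal

namespace Literature.Analysis.FluidPDE

namespace Elgindi

/-! ### The parameter `μ₁` and the datum `Γ̄` -/

/-- `μ₁ = −α(α+5)`, the eigenvalue of `L_z = −α²D_z² − 5αD_z` on `z`. [cite: Elgindi2021, §8.3 (p. 27 of arXiv:1904.04795): "`α²z²∂_{zz}G + α(5+α)z∂_zG`"] -/
def muOne (α : ℝ) : ℝ := -(α * (α + 5))

/-- `|μ₁| ≤ 1/39` for `0 < α ≤ 1/200`. [folklore] -/
theorem abs_muOne_le {α : ℝ} (hα : 0 < α) (hα' : α ≤ 1 / 200) : |muOne α| ≤ 1 / 39 := by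
  unfold muOne
  rw [abs_neg, abs_of_nonneg (by positivity)]
  nlinarith

/-- **`Γ̄ = Γ − (5c/4) sin 2θ`**, the part of the angular profile `Γ` orthogonal to the adjoint kernel
`sin θ cos²θ` (`⟨Γ, K₀⟩ = c/3`, `⟨sin 2θ, K₀⟩ = 4/15`). [cite: Elgindi2021, §8.3 proof of Proposition 8.13 (p. 27 of arXiv:1904.04795): "`F̄_* = F_* − (15/2) sin(2θ) αz/(1+z)²` (so that `∫₀^{π/2} F̄_* K = 0`)"] -/
def gammaBar (α θ : ℝ) : ℝ := angularWeight α θ - 5 / 4 * profileConst α * Real.sin (2 * θ)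

/-- `Γ̄` is continuous for `α ≥ 0`. [folklore] -/
theorem continuous_gammaBar {α : ℝ} (hα : 0 ≤ α) : Continuous (gammaBar α) := by
  unfold gammaBar
  exact (continuous_angularWeight hα).sub (by fun_prop)

/-- **`|Γ̄| ≤ 9/4`** on `[0, π/2]` for `α ≥ 0`. [folklore] -/
theorem abs_gammaBar_le {α : ℝ} (hα : 0 ≤ α) {θ : ℝ} (hθ : θ ∈ Icc 0 (π / 2)) : |gammaBar α θ| ≤ 9 / 4 := by
  have h1 := angularWeight_le_one hα hθ
  have h0 := angularWeight_nonneg α hθ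
  have hc0 := (profileConst_pos hα).le
  have hc1 := profileConst_le_one hα
  have hs : |Real.sin (2 * θ)| ≤ 1 := Real.abs_sin_le_one _
  unfold gammaBar
  calc |angularWeight α θ - 5 / 4 * profileConst α * Real.sin (2 * θ)|
      ≤ |angularWeight α θ| + |5 / 4 * profileConst α * Real.sin (2 * θ)| := abs_sub _ _
    _ ≤ 1 + 5 / 4 * 1 * 1 := by
        refine add_le_add (by rw [abs_of_nonneg h0]; exact h1) ?_
        rw [abs_mul, abs_mul, abs_of_nonneg (by norm_num : (0:ℝ) ≤ 5 / 4), abs_of_nonneg hc0]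
        exact mul_le_mul (mul_le_mul_of_nonneg_left hc1 (by norm_num)) hs (abs_nonneg _) (by positivity)
    _ = 9 / 4 := by norm_num

/-! ### The datum, the projection and the raw step -/

/-- The datum of one fixed-point step: `h_χ = Γ̄ − μ₁ cos θ·χ`. [folklore] -/
def corrData (α : ℝ) (χ : ℝ → ℝ) (β : ℝ) : ℝ := gammaBar α β - muOne α * Real.cos β * χ β

/-- **The projection coefficient `c(y) = (15/2)∫₀^{π/2} cos β·y(β)·sin β cos²β dβ`**: `y − c(y) sin θ`
is the representative of `y + ℝ sin θ` with `cos θ·(y − c(y) sin θ) ⊥ sin θ cos²θ`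
(`∫₀^{π/2} sin²β cos³β dβ = 2/15`). [folklore] -/
def projCoeff (y : ℝ → ℝ) : ℝ := 15 / 2 * ∫ β in (0:ℝ)..(π / 2), Real.cos β * y β * (Real.sin β * Real.cos β ^ 2)

/-- **The raw step `F_χ = 𝒦h_χ − c(𝒦h_χ) sin θ`** on `[0, π/2]`. [folklore] -/
def corrRaw (α : ℝ) (χ : ℝ → ℝ) (θ : ℝ) : ℝ := greenOp (corrData α χ) θ - projCoeff (greenOp (corrData α χ)) * Real.sin θ

/-- The clamp onto `[0, π/2]`. [folklore] -/
def clampI (θ : ℝ) : ℝ := max 0 (min θ (π / 2))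

/-- The clamp takes values in `[0, π/2]`. [folklore] -/
theorem clampI_mem (θ : ℝ) : clampI θ ∈ Icc 0 (π / 2) := by
  unfold clampI
  refine ⟨le_max_left _ _, max_le (by positivity) (min_le_right _ _)⟩

/-- The clamp is the identity on `[0, π/2]`. [folklore] -/
theorem clampI_of_mem {θ : ℝ} (hθ : θ ∈ Icc 0 (π / 2)) : clampI θ = θ := by
  unfold clampI
  rw [min_eq_left hθ.2, max_eq_right hθ.1]

/-- `∫₀^{π/2} cos β sin β cos²β dβ = 1/4`. [folklore] -/
theorem integral_cos_mul_K0 : ∫ β in (0:ℝ)..(π / 2), Real.cos β * (Real.sin β * Real.cos β ^ 2) = 1 / 4 := by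
  have hd : ∀ x ∈ uIcc (0:ℝ) (π / 2), HasDerivAt (fun β => -(Real.cos β ^ 4 / 4)) (Real.cos x * (Real.sin x * Real.cos x ^ 2)) x := by
    intro x _
    have h := (((Real.hasDerivAt_cos x).fun_pow 4).div_const 4).neg
    refine h.congr_deriv ?_
    push_cast; ring
  rw [integral_eq_sub_of_hasDerivAt hd (by apply Continuous.intervalIntegrable; fun_prop), Real.cos_pi_div_two, Real.cos_zero]
  norm_num

/-- **`|c(y)| ≤ (15/8)M`** when `|y| ≤ M` on `[0, π/2]` (`y` continuous there). [folklore] -/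
theorem abs_projCoeff_le {y : ℝ → ℝ} (hy : ContinuousOn y (Icc 0 (π / 2))) {M : ℝ} (hM : ∀ θ ∈ Icc 0 (π / 2), |y θ| ≤ M) :
    |projCoeff y| ≤ 15 / 8 * M := by
  have hM0 : 0 ≤ M := (abs_nonneg _).trans (hM 0 ⟨le_rfl, by positivity⟩)
  have hle : ∀ x ∈ Icc (0:ℝ) (π / 2), |Real.cos x * y x * (Real.sin x * Real.cos x ^ 2)| ≤ M * (Real.cos x * (Real.sin x * Real.cos x ^ 2)) := by
    intro x hx
    have hc : 0 ≤ Real.cos x := Real.cos_nonneg_of_mem_Icc ⟨by linarith [hx.1, Real.pi_pos], hx.2⟩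
    have hs : 0 ≤ Real.sin x := Real.sin_nonneg_of_nonneg_of_le_pi hx.1 (by linarith [hx.2, Real.pi_pos])
    have hK : 0 ≤ Real.cos x * (Real.sin x * Real.cos x ^ 2) := by positivity
    rw [show Real.cos x * y x * (Real.sin x * Real.cos x ^ 2) = y x * (Real.cos x * (Real.sin x * Real.cos x ^ 2)) by ring,
      abs_mul, abs_of_nonneg hK]
    exact mul_le_mul_of_nonneg_right (hM x hx) hK
  have hπ : (0:ℝ) ≤ π / 2 := by positivity
  have hcont : ContinuousOn (fun β => Real.cos β * y β * (Real.sin β * Real.cos β ^ 2)) (Icc 0 (π / 2)) :=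
    (Real.continuous_cos.continuousOn.mul hy).mul (Continuous.continuousOn (by fun_prop))
  have h1 : |∫ β in (0:ℝ)..(π / 2), Real.cos β * y β * (Real.sin β * Real.cos β ^ 2)| ≤ M * (1 / 4) := by
    calc |∫ β in (0:ℝ)..(π / 2), Real.cos β * y β * (Real.sin β * Real.cos β ^ 2)|
        ≤ ∫ β in (0:ℝ)..(π / 2), |Real.cos β * y β * (Real.sin β * Real.cos β ^ 2)| := abs_integral_le_integral_abs hπ
      _ ≤ ∫ β in (0:ℝ)..(π / 2), M * (Real.cos β * (Real.sin β * Real.cos β ^ 2)) :=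
          integral_mono_on hπ (hcont.norm.intervalIntegrable_of_Icc hπ) (by apply Continuous.intervalIntegrable; fun_prop) hle
      _ = M * (1 / 4) := by rw [intervalIntegral.integral_const_mul, integral_cos_mul_K0]
  unfold projCoeff
  rw [abs_mul, abs_of_pos (by norm_num : (0:ℝ) < 15 / 2)]
  linarith

/-! ### Linearity and localisation -/

/-- `𝒦` is linear: `𝒦(h₁ − h₂) = 𝒦h₁ − 𝒦h₂` on `[0, π/2]`. [folklore] -/
theorem greenOp_sub {h₁ h₂ : ℝ → ℝ} (hc₁ : ContinuousOn h₁ (Icc 0 (π / 2))) (hc₂ : ContinuousOn h₂ (Icc 0 (π / 2)))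
    {θ : ℝ} (hθ : θ ∈ Icc 0 (π / 2)) :
    greenOp (fun β => h₁ β - h₂ β) θ = greenOp h₁ θ - greenOp h₂ θ := by
  have z0 : (0:ℝ) ∈ Icc 0 (π / 2) := ⟨le_rfl, by positivity⟩
  have p0 : π / 2 ∈ Icc 0 (π / 2) := ⟨by positivity, le_rfl⟩
  have e1 : greenI1 (fun β => h₁ β - h₂ β) θ = greenI1 h₁ θ - greenI1 h₂ θ := by
    unfold greenI1
    rw [← intervalIntegral.integral_sub (intervalIntegrable_greenK2_mul hc₁ z0 hθ) (intervalIntegrable_greenK2_mul hc₂ z0 hθ)]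
    refine intervalIntegral.integral_congr fun β _ => ?_
    ring
  have e2 : greenI2 (fun β => h₁ β - h₂ β) θ = greenI2 h₁ θ - greenI2 h₂ θ := by
    unfold greenI2
    rw [← intervalIntegral.integral_sub (intervalIntegrable_K0_mul hc₁ hθ p0) (intervalIntegrable_K0_mul hc₂ hθ p0)]
    refine intervalIntegral.integral_congr fun β _ => ?_
    ring
  unfold greenOp
  rw [e1, e2]; ring

/-- `c(·)` only depends on the values on `[0, π/2]`. [folklore] -/
theorem projCoeff_congr {y₁ y₂ : ℝ → ℝ} (h : ∀ β ∈ Icc 0 (π / 2), y₁ β = y₂ β) : projCoeff y₁ = projCoeff y₂ := by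
  unfold projCoeff
  congr 1
  refine intervalIntegral.integral_congr fun β hβ => ?_
  rw [uIcc_of_le (by positivity : (0:ℝ) ≤ π / 2)] at hβ
  simp only [h β hβ]

/-- `c(·)` is linear on functions continuous on `[0, π/2]`. [folklore] -/
theorem projCoeff_sub {y₁ y₂ : ℝ → ℝ} (hy₁ : ContinuousOn y₁ (Icc 0 (π / 2))) (hy₂ : ContinuousOn y₂ (Icc 0 (π / 2))) :
    projCoeff (fun β => y₁ β - y₂ β) = projCoeff y₁ - projCoeff y₂ := by
  have hπ : (0:ℝ) ≤ π / 2 := by positivity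
  have hi : ∀ {y : ℝ → ℝ}, ContinuousOn y (Icc 0 (π / 2)) →
      IntervalIntegrable (fun β => Real.cos β * y β * (Real.sin β * Real.cos β ^ 2)) volume 0 (π / 2) := fun hy =>
    ((Real.continuous_cos.continuousOn.mul hy).mul (Continuous.continuousOn (by fun_prop))).intervalIntegrable_of_Icc hπ
  unfold projCoeff
  rw [← mul_sub, ← intervalIntegral.integral_sub (hi hy₁) (hi hy₂)]
  congr 1
  refine intervalIntegral.integral_congr fun β _ => ?_
  ring

/-! ### The step on bounded continuous functions -/

section step

variable {α : ℝ} (hα : 0 ≤ α)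
include hα

/-- The datum `h_χ` is continuous. [folklore] -/
theorem continuous_corrData (χ : ℝ →ᵇ ℝ) : Continuous (corrData α χ) := by
  unfold corrData
  exact (continuous_gammaBar hα).sub ((continuous_const.mul Real.continuous_cos).mul χ.continuous)

/-- **`|h_χ| ≤ 9/4 + |μ₁|‖χ‖`** on `[0, π/2]`. [folklore] -/
theorem abs_corrData_le (χ : ℝ →ᵇ ℝ) {θ : ℝ} (hθ : θ ∈ Icc 0 (π / 2)) :
    |corrData α χ θ| ≤ 9 / 4 + |muOne α| * ‖χ‖ := by
  have h1 := abs_gammaBar_le hα hθ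
  have h2 : |muOne α * Real.cos θ * χ θ| ≤ |muOne α| * ‖χ‖ := by
    rw [abs_mul, abs_mul]
    calc |muOne α| * |Real.cos θ| * |χ θ| ≤ |muOne α| * 1 * ‖χ‖ :=
          mul_le_mul (mul_le_mul_of_nonneg_left (Real.abs_cos_le_one θ) (abs_nonneg _)) (χ.norm_coe_le_norm θ) (abs_nonneg _) (by positivity)
      _ = |muOne α| * ‖χ‖ := by ring
  unfold corrData
  exact (abs_sub _ _).trans (add_le_add h1 h2)

/-- Continuity of `𝒦h_χ` on `[0, π/2]`. [folklore] -/
theorem continuousOn_greenOp_corrData (χ : ℝ →ᵇ ℝ) : ContinuousOn (greenOp (corrData α χ)) (Icc 0 (π / 2)) :=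
  continuousOn_greenOp (continuous_corrData hα χ).continuousOn (fun _ hθ => abs_corrData_le hα χ hθ)

/-- **`|F_χ| ≤ 30(9/4 + |μ₁|‖χ‖)`** on `[0, π/2]`. [folklore] -/
theorem abs_corrRaw_le (χ : ℝ →ᵇ ℝ) {θ : ℝ} (hθ : θ ∈ Icc 0 (π / 2)) :
    |corrRaw α χ θ| ≤ 30 * (9 / 4 + |muOne α| * ‖χ‖) := by
  set B := 9 / 4 + |muOne α| * ‖χ‖ with hB
  have hB0 : 0 ≤ B := by positivity
  have hc := (continuous_corrData hα χ).continuousOn (s := Icc 0 (π / 2))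
  have hbd : ∀ θ ∈ Icc (0:ℝ) (π / 2), |corrData α χ θ| ≤ B := fun θ hθ => abs_corrData_le hα χ hθ
  have h1 : |greenOp (corrData α χ) θ| ≤ 10 * B := abs_greenOp_le hc hbd hθ
  have h2 : |projCoeff (greenOp (corrData α χ))| ≤ 15 / 8 * (10 * B) :=
    abs_projCoeff_le (continuousOn_greenOp_corrData hα χ) fun θ hθ => abs_greenOp_le hc hbd hθ
  have hs : |Real.sin θ| ≤ 1 := Real.abs_sin_le_one θ
  unfold corrRaw
  calc |greenOp (corrData α χ) θ - projCoeff (greenOp (corrData α χ)) * Real.sin θ|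
      ≤ |greenOp (corrData α χ) θ| + |projCoeff (greenOp (corrData α χ))| * |Real.sin θ| := by rw [← abs_mul]; exact abs_sub _ _
    _ ≤ 10 * B + 15 / 8 * (10 * B) * 1 := add_le_add h1 (mul_le_mul h2 hs (abs_nonneg _) (by positivity))
    _ ≤ 30 * B := by nlinarith

/-- Continuity of `F_χ` on `[0, π/2]`. [folklore] -/
theorem continuousOn_corrRaw (χ : ℝ →ᵇ ℝ) : ContinuousOn (corrRaw α χ) (Icc 0 (π / 2)) := by
  unfold corrRaw
  exact (continuousOn_greenOp_corrData hα χ).sub (continuousOn_const.mul Real.continuous_sin.continuousOn)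

/-- Continuity of the clamped step. [folklore] -/
theorem continuous_corrRaw_clampI (χ : ℝ →ᵇ ℝ) : Continuous fun θ => corrRaw α χ (clampI θ) :=
  (continuousOn_corrRaw hα χ).comp_continuous (by unfold clampI; fun_prop) clampI_mem

end step

/-- **One step of the contraction, `A(χ) = Π𝒦(Γ̄ − μ₁cos θ·χ)`**, as a map of `ℝ →ᵇ ℝ` (the function
of `[0, π/2]` extended by clamping; `0` for `α < 0`). [folklore] -/
def corrStep (α : ℝ) (χ : ℝ →ᵇ ℝ) : ℝ →ᵇ ℝ :=
  if hα : 0 ≤ α then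
    ofNormedAddCommGroup (fun θ => corrRaw α χ (clampI θ)) (continuous_corrRaw_clampI hα χ) (30 * (9 / 4 + |muOne α| * ‖χ‖))
      (fun θ => by rw [Real.norm_eq_abs]; exact abs_corrRaw_le hα χ (clampI_mem θ))
  else 0

/-- The values of the step. [folklore] -/
theorem corrStep_apply {α : ℝ} (hα : 0 ≤ α) (χ : ℝ →ᵇ ℝ) (θ : ℝ) : corrStep α χ θ = corrRaw α χ (clampI θ) := by
  unfold corrStep
  rw [dif_pos hα]
  rfl

/-- The norm of the step. [folklore] -/
theorem norm_corrStep_le {α : ℝ} (hα : 0 ≤ α) (χ : ℝ →ᵇ ℝ) : ‖corrStep α χ‖ ≤ 30 * (9 / 4 + |muOne α| * ‖χ‖) := by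
  rw [norm_le (by positivity)]
  intro θ
  rw [corrStep_apply hα, Real.norm_eq_abs]
  exact abs_corrRaw_le hα χ (clampI_mem θ)

/-- **The step is `30|μ₁|`-Lipschitz.** [folklore] -/
theorem dist_corrStep_le {α : ℝ} (hα : 0 ≤ α) (χ₁ χ₂ : ℝ →ᵇ ℝ) :
    dist (corrStep α χ₁) (corrStep α χ₂) ≤ 30 * |muOne α| * dist χ₁ χ₂ := by
  rw [dist_le (by positivity)]
  intro θ
  rw [corrStep_apply hα, corrStep_apply hα, Real.dist_eq]
  set t := clampI θ with ht
  have htI : t ∈ Icc 0 (π / 2) := clampI_mem θ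
  -- the difference datum `e = −μ₁ cos·(χ₁ − χ₂)`
  set e : ℝ → ℝ := fun β => corrData α χ₁ β - corrData α χ₂ β with he
  have he' : ∀ β, e β = -(muOne α * Real.cos β * (χ₁ β - χ₂ β)) := fun β => by simp only [he, corrData]; ring
  have hec : Continuous e := (continuous_corrData hα χ₁).sub (continuous_corrData hα χ₂)
  set d := dist χ₁ χ₂ with hd
  have hebd : ∀ β ∈ Icc (0:ℝ) (π / 2), |e β| ≤ |muOne α| * d := by
    intro β _
    rw [he', abs_neg, abs_mul, abs_mul]
    calc |muOne α| * |Real.cos β| * |χ₁ β - χ₂ β| ≤ |muOne α| * 1 * d := by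
          refine mul_le_mul (mul_le_mul_of_nonneg_left (Real.abs_cos_le_one β) (abs_nonneg _)) ?_ (abs_nonneg _) (by positivity)
          rw [← Real.dist_eq]; exact dist_coe_le_dist β
      _ = |muOne α| * d := by ring
  have hc₁ := (continuous_corrData hα χ₁).continuousOn (s := Icc 0 (π / 2))
  have hc₂ := (continuous_corrData hα χ₂).continuousOn (s := Icc 0 (π / 2))
  have hG : ∀ β ∈ Icc (0:ℝ) (π / 2), greenOp (corrData α χ₁) β - greenOp (corrData α χ₂) β = greenOp e β :=
    fun β hβ => (greenOp_sub hc₁ hc₂ hβ).symm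
  have hGe : ∀ β ∈ Icc (0:ℝ) (π / 2), |greenOp e β| ≤ 10 * (|muOne α| * d) := fun β hβ => abs_greenOp_le hec.continuousOn hebd hβ
  have hP : projCoeff (greenOp (corrData α χ₁)) - projCoeff (greenOp (corrData α χ₂)) = projCoeff (greenOp e) := by
    rw [← projCoeff_sub (continuousOn_greenOp_corrData hα χ₁) (continuousOn_greenOp_corrData hα χ₂)]
    exact projCoeff_congr hG
  have hPe : |projCoeff (greenOp e)| ≤ 15 / 8 * (10 * (|muOne α| * d)) :=
    abs_projCoeff_le (continuousOn_greenOp hec.continuousOn hebd) hGe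
  have hs : |Real.sin t| ≤ 1 := Real.abs_sin_le_one t
  have e1 : corrRaw α χ₁ t - corrRaw α χ₂ t =
      (greenOp (corrData α χ₁) t - greenOp (corrData α χ₂) t) - (projCoeff (greenOp (corrData α χ₁)) - projCoeff (greenOp (corrData α χ₂))) * Real.sin t := by
    unfold corrRaw; ring
  rw [e1, hG t htI, hP]
  calc |greenOp e t - projCoeff (greenOp e) * Real.sin t| ≤ |greenOp e t| + |projCoeff (greenOp e)| * |Real.sin t| := by
        rw [← abs_mul]; exact abs_sub _ _
    _ ≤ 10 * (|muOne α| * d) + 15 / 8 * (10 * (|muOne α| * d)) * 1 := add_le_add (hGe t htI) (mul_le_mul hPe hs (abs_nonneg _) (by positivity))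
    _ ≤ 30 * |muOne α| * d := by nlinarith [abs_nonneg (muOne α), (dist_nonneg : 0 ≤ d)]

/-- **The step is a contraction for `0 < α ≤ 1/200`** (factor `30|μ₁| ≤ 30/39`). [folklore] -/
theorem corrStep_contracting {α : ℝ} (hα : 0 < α) (hα' : α ≤ 1 / 200) :
    ContractingWith ⟨30 * |muOne α|, by positivity⟩ (corrStep α) := by
  refine ⟨?_, LipschitzWith.of_dist_le_mul fun χ₁ χ₂ => ?_⟩
  · have h := abs_muOne_le hα hα'
    rw [← NNReal.coe_lt_coe]
    show (30 * |muOne α| : ℝ) < ((1 : ℝ≥0) : ℝ)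
    rw [NNReal.coe_one]; nlinarith
  · exact dist_corrStep_le hα.le χ₁ χ₂

/-! ### The corrector `χ₁` and `ψ₁ = cos θ·χ₁` -/

/-- **The angular corrector in the `χ`-variable**: the fixed point `χ₁ = A(χ₁)` (for
`0 < α ≤ 1/200`; `0` otherwise). [cite: Elgindi2021, §8.3 Proposition 8.13 (p. 27 of arXiv:1904.04795): the angular problem behind the structure of Φ_*] -/
def chiOne (α : ℝ) : ℝ →ᵇ ℝ :=
  if h : 0 < α ∧ α ≤ 1 / 200 then ContractingWith.fixedPoint (corrStep α) (corrStep_contracting h.1 h.2) else 0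

/-- **The angular corrector `ψ₁ = cos θ·χ₁`** of the profile: the solution of `(L_θ + μ₁)ψ₁ = Γ̄`,
`ψ₁(0) = ψ₁(π/2) = 0`, `ψ₁ ⊥ sin θ cos²θ`. [cite: Elgindi2021, §8.3 Proposition 8.13 (p. 27 of arXiv:1904.04795); ElgindiGhoulMasmoudi2021, §2.3.1 (2.10)–(2.12) (p. 9 of arXiv:1910.14071)] -/
def psiOne (α θ : ℝ) : ℝ := Real.cos θ * chiOne α θ

section corrector

variable {α : ℝ} (hα : 0 < α) (hα' : α ≤ 1 / 200)
include hα hα'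

/-- `χ₁` is the fixed point of the step. [folklore] -/
theorem chiOne_isFixedPt : corrStep α (chiOne α) = chiOne α := by
  unfold chiOne
  rw [dif_pos ⟨hα, hα'⟩]
  exact ContractingWith.fixedPoint_isFixedPt _

/-- **The fixed-point equation on `[0, π/2]`: `χ₁ = 𝒦(Γ̄ − μ₁cos θ·χ₁) − c·sin θ`.** [folklore] -/
theorem chiOne_eq {θ : ℝ} (hθ : θ ∈ Icc 0 (π / 2)) : chiOne α θ = corrRaw α (chiOne α) θ := by
  have h := congrArg (fun f : ℝ →ᵇ ℝ => f θ) (chiOne_isFixedPt hα hα')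
  rw [corrStep_apply hα.le, clampI_of_mem hθ] at h
  exact h.symm

/-- **`‖χ₁‖ ≤ 300`.** [folklore] -/
theorem norm_chiOne_le : ‖chiOne α‖ ≤ 300 := by
  have hK := corrStep_contracting hα hα'
  have hμ := abs_muOne_le hα hα'
  have h := hK.dist_fixedPoint_le (0 : ℝ →ᵇ ℝ)
  have e : ContractingWith.fixedPoint (corrStep α) hK = chiOne α := by
    unfold chiOne; rw [dif_pos ⟨hα, hα'⟩]
  rw [e, dist_zero_left] at h
  have h0 : dist (0 : ℝ →ᵇ ℝ) (corrStep α 0) ≤ 30 * (9 / 4) := by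
    rw [dist_zero_left]
    have := norm_corrStep_le hα.le (0 : ℝ →ᵇ ℝ)
    rw [norm_zero, mul_zero, add_zero] at this
    exact this
  have hden : (9 / 39 : ℝ) ≤ 1 - ((⟨30 * |muOne α|, by positivity⟩ : ℝ≥0) : ℝ) := by
    show (9 / 39 : ℝ) ≤ 1 - 30 * |muOne α|
    nlinarith
  calc ‖chiOne α‖ ≤ dist (0 : ℝ →ᵇ ℝ) (corrStep α 0) / (1 - ((⟨30 * |muOne α|, by positivity⟩ : ℝ≥0) : ℝ)) := h
    _ ≤ (30 * (9 / 4)) / (9 / 39) := div_le_div₀ (by norm_num) h0 (by norm_num) hden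
    _ ≤ 300 := by norm_num

/-- **`|Γ̄ − μ₁cos θ·χ₁| ≤ 10`** on `[0, π/2]` (the datum of `χ₁`). [folklore] -/
theorem abs_corrData_chiOne_le {θ : ℝ} (hθ : θ ∈ Icc 0 (π / 2)) : |corrData α (chiOne α) θ| ≤ 10 := by
  have h := abs_corrData_le hα.le (chiOne α) hθ
  have hμ := abs_muOne_le hα hα'
  have hn := norm_chiOne_le hα hα'
  calc |corrData α (chiOne α) θ| ≤ 9 / 4 + |muOne α| * ‖chiOne α‖ := h
    _ ≤ 9 / 4 + 1 / 39 * 300 := by gcongr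
    _ ≤ 10 := by norm_num

/-- `|χ₁| ≤ 300` pointwise. [folklore] -/
theorem abs_chiOne_le (θ : ℝ) : |chiOne α θ| ≤ 300 :=
  (Real.norm_eq_abs _ ▸ (chiOne α).norm_coe_le_norm θ).trans (norm_chiOne_le hα hα')

/-- `|ψ₁| ≤ 300·cos θ` on `[0, π/2]`; in particular `ψ₁ → 0` at `π/2`. [folklore] -/
theorem abs_psiOne_le {θ : ℝ} (hθ : θ ∈ Icc 0 (π / 2)) : |psiOne α θ| ≤ 300 * Real.cos θ := by
  have hc : 0 ≤ Real.cos θ := Real.cos_nonneg_of_mem_Icc ⟨by linarith [hθ.1, Real.pi_pos], hθ.2⟩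
  unfold psiOne
  rw [abs_mul, abs_of_nonneg hc, mul_comm]
  exact mul_le_mul_of_nonneg_right (abs_chiOne_le hα hα' θ) hc

end corrector

end Elgindi

end Literature.Analysis.FluidPDE
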